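import Literature.AlgebraicGeometry.Resolution.GeneralizedStabilityRankOneVTGalois
import HarnessLib

/-!
# Generalized stability for `K(x)^h`: every finite extension is defectless — the assembly (Kuhlmann 2010, §5, proof of (R4))

Topic: `Literature/AlgebraicGeometry/Resolution` (valued function fields). Third of three files
assembling the named fact `Kuhlmann2010StabilityHenselizedRationalValueTranscendental`
(`GeneralizedStabilityRankOneVT.lean`) = F.-V. Kuhlmann, *Elimination of ramification I: The
generalized stability theorem*, Trans. AMS 362 (2010) 5697–5727 = arXiv:1003.5678, §5, proof
of (R4) (pp. 18–20), value-transcendental case: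

> More generally, we will now prove our assertion under the assumption that `(F|K,v)` is a
> henselized inertially generated function field of rank 1 and transcendence degree 1 with a
> valuation-transcendental generator over the algebraically closed field `K`. Given an
> arbitrary finite extension `(E|F,v)`, we have to show that it is defectless.

from the named facts `Kuhlmann2010HenselizationIsHenselian` (§1.1 / Lemma 2.3,
`Henselization.lean`), `Kuhlmann2010OstrowskiLemma` (§2.3 (9)),
`Kuhlmann2010HenselizedRationalImmediateExt` (the italicized statement of §5, p. 19) and
`Kuhlmann2010Lemma55ValueTranscendental` (Lemma 5.5, Case I) of
`GeneralizedStabilityHenselizedRational.lean`. After the Galois case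
(`isDefectlessPair_of_isGalois`, `GeneralizedStabilityRankOneVTGalois.lean`) it remains to
treat an arbitrary finite `E ⊇ F = K(x)^h` inside `Ω`: its separable part embeds into a finite
Galois extension inside `Ω` (generated by the `Ω`-roots of the minimal polynomials of finitely
many generators), to which defectlessness descends by Lemma 2.13; the purely inseparable part
is a tower of steps `N ≤ N(b)`, `b ∉ N`, `b^p ∈ N`, of degree `p`, each defectless by the
italicized statement and each `N(b)` again a `K(x')^h` (Lemma 5.5). Finally an abstract
finite extension `L` of `F` is embedded into `Ω` over `F` (`IsAlgClosed.lift`), where `V ∩ E`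
is the unique extension of `V ∩ F` (`F` henselian), and `[E : F] = e f` is transported back
to `L` (`IsDefectlessIn.congr`, `DefectTransport.lean`).

## Content (everything PROVED)

* `ringExpChar_residueField_eq` — in characteristic `q > 1` the residue field of `V` has
  characteristic exponent `q`.
* `isDefectlessPair_of_isSeparable` — finite separable extensions of `K(x)^h`-fields are
  defectless (Galois closure inside `Ω` + Lemma 2.13).
* `isDefectlessPair_of_pow_mem` — extensions of `K(x)^h`-fields reached by `q`-power roots
  (purely inseparable) are defectless (induction through steps of degree `p`).
* `isDefectlessPair_of_isHenselizedRationalVT` — **every finite `E ⊇ K(x)^h` inside `Ω`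
  satisfies `[E : K(x)^h] = (vE : vK(x)^h)[Ev : K(x)^h v]`** (separable closure + the two cases +
  Lemma 2.13).
* `Kuhlmann2010StabilityHenselizedRationalValueTranscendental.of_parts :
  Kuhlmann2010HenselizationIsHenselian → Kuhlmann2010OstrowskiLemma →
  Kuhlmann2010HenselizedRationalImmediateExt → Kuhlmann2010Lemma55ValueTranscendental →
  Kuhlmann2010StabilityHenselizedRationalValueTranscendental` — the assembly; and with
  Thm. 2.14, `Kuhlmann2010StabilityRankOneValueTranscendental.of_facts` — **(R4) for `K(t)` of
  rank one with a value-transcendental generator over an algebraically closed `K`** from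
  `Kuhlmann2010DefectlessIffHenselization` and the four facts above
  (`Kuhlmann2010StabilityRankOneValueTranscendental.of_parts`, `GeneralizedStabilityRankOneVT.lean`).

## Sources

* F.-V. Kuhlmann, *Elimination of ramification I: The generalized stability theorem*, Trans.
  Amer. Math. Soc. 362 (2010) 5697–5727 = arXiv:1003.5678: §1.1, §2.3 ((9), Lemma 2.13,
  Thm. 2.14, Cor. 2.15), Lemma 2.3, §2.5, Prop. 3.1 (the purely inseparable steps), §5 (proof
  of (R4), pp. 18–20; Lemma 5.5).

## Rendering notes

* The trust base of `Kuhlmann2010StabilityRankOneValueTranscendental.of_facts` is exactly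
  {Thm. 2.14, "henselization is henselian", Ostrowski (9), the italicized statement of §5 for
  `K(x)^h` with a value-transcendental generator, Lemma 5.5 Case I}; the italicized statement
  carries the heart of the paper (ramification theory, Prop. 2.18, Lemma 2.27, §4.1 normal
  forms, Prop. 3.1).
-/

noncomputable section

open IsLocalRing

namespace Literature.AlgebraicGeometry.Resolution

universe u

section Induction

variable {Ω : Type u} [Field Ω] {V : ValuationSubring Ω} {K : Subfield Ω} [IsAlgClosed Ω]

/-! ### The separable case: pass to a Galois closure inside `Ω` -/

omit [IsAlgClosed Ω] in
/-- If the characteristic exponent `q` of `Ω` is `> 1`, the residue field of `V` has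
characteristic exponent `q` as well (`q = char Ω` is prime, `V → Ṽ` kills `q`). [folklore] -/
theorem ringExpChar_residueField_eq (hq : 1 < ringExpChar Ω) :
    ringExpChar (ResidueField V) = ringExpChar Ω := by
  have hdef : ringExpChar Ω = max (ringChar Ω) 1 := rfl
  have hrc : ringChar Ω = ringExpChar Ω := by omega
  have hqprime : (ringExpChar Ω).Prime :=
    (expChar_is_prime_or_one Ω (ringExpChar Ω)).resolve_right (by omega)
  haveI hΩ : CharP Ω (ringExpChar Ω) := ringChar.eq_iff.mp hrc
  have h0 : ((ringExpChar Ω : ℕ) : ResidueField V) = 0 := by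
    have h1 : ((ringExpChar Ω : ℕ) : V) = 0 :=
      Subtype.ext (by push_cast; exact CharP.cast_eq_zero Ω (ringExpChar Ω))
    rw [← map_natCast (residue V), h1, map_zero]
  have hdvd : ringChar (ResidueField V) ∣ ringExpChar Ω := ringChar.dvd h0
  have hne1 : ringChar (ResidueField V) ≠ 1 := CharP.ringChar_ne_one
  have hrc' : ringChar (ResidueField V) = ringExpChar Ω :=
    ((Nat.dvd_prime hqprime).mp hdvd).resolve_left hne1
  have hdef' : ringExpChar (ResidueField V) = max (ringChar (ResidueField V)) 1 := rfl
  omega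

/-- **Finite separable extensions of `K(x)^h`-fields are defectless**: embed `E|M` into a
finite Galois extension `N|M` inside `Ω` (the field generated over `M` by all `Ω`-roots of the
minimal polynomials of finitely many generators of `E`), which is defectless by the Galois
case; defectlessness descends to `E|M` by multiplicativity (Lemma 2.13).
[cite: Kuhlmann2010, Section 5, proof of Thm. 1.1 (pp. 19–20)] -/
theorem isDefectlessPair_of_isSeparable (hyp : VTHypotheses K) {M E : Subfield Ω} (h : M ≤ E)
    (hM : IsHenselizedRationalVT V K M) (hfin : RelFinite M E h)
    (hsep : letI : Algebra M E := (Subfield.inclusion h).toAlgebra; Algebra.IsSeparable M E) :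
    IsDefectlessPair V M E h := by
  classical
  letI : Algebra M E := (Subfield.inclusion h).toAlgebra
  haveI : IsScalarTower M E Ω := IsScalarTower.of_algebraMap_eq fun _ => rfl
  haveI : FiniteDimensional M E := hfin
  haveI : Algebra.IsSeparable M E := hsep
  obtain ⟨s, hsE, hsgen⟩ := exists_finset_closure_eq_of_relFinite h hfin
  -- the polynomial whose roots generate the Galois closure
  have hint : ∀ y ∈ s, IsIntegral M y := fun y hy =>
    (forall_isAlgebraic_of_relFinite h hfin y (hsE hy)).isIntegral
  let q : Polynomial M := ∏ y ∈ s, minpoly M y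
  have hq0 : q ≠ 0 := Finset.prod_ne_zero_iff.mpr fun y hy => minpoly.ne_zero (hint y hy)
  let N₀ : IntermediateField M Ω := IntermediateField.adjoin M (q.rootSet Ω)
  haveI : Polynomial.IsSplittingField M N₀ q :=
    IntermediateField.adjoin_rootSet_isSplittingField (IsAlgClosed.splits _)
  haveI : FiniteDimensional M N₀ := Polynomial.IsSplittingField.finiteDimensional N₀ q
  haveI : Normal M N₀ := Normal.of_isSplittingField q
  -- separability: every root of `q` has the minimal polynomial of a separable generator
  have hsepy : ∀ y ∈ s, IsSeparable M y := fun y hy => by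
    have h1 : IsSeparable M (⟨y, hsE hy⟩ : E) := Algebra.IsSeparable.isSeparable M _
    have h2 : minpoly M y = minpoly M (⟨y, hsE hy⟩ : E) := by
      rw [← minpoly.algebraMap_eq (A := M) (B := E) (B' := Ω) Subtype.val_injective ⟨y, hsE hy⟩]
      rfl
    unfold IsSeparable
    rw [h2]
    exact h1
  haveI : Algebra.IsSeparable M N₀ := by
    refine (IntermediateField.isSeparable_adjoin_iff_isSeparable M Ω).mpr fun z hz => ?_
    obtain ⟨-, hz0⟩ := Polynomial.mem_rootSet.mp hz
    rw [Polynomial.aeval_def, Polynomial.eval₂_finsetProd, Finset.prod_eq_zero_iff] at hz0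
    obtain ⟨y, hy, hzy⟩ := hz0
    have hirr : Irreducible (minpoly M y) := minpoly.irreducible (hint y hy)
    have hmonic : (minpoly M y).Monic := minpoly.monic (hint y hy)
    have heq : minpoly M y = minpoly M z :=
      minpoly.eq_of_irreducible_of_monic hirr (by rwa [Polynomial.aeval_def]) hmonic
    unfold IsSeparable
    rw [← heq]
    exact hsepy y hy
  haveI : IsGalois M N₀ := isGalois_iff.mpr ⟨inferInstance, inferInstance⟩
  -- the subfield `N` of `Ω`
  let N : Subfield Ω := N₀.toSubfield
  have hMN : M ≤ N := fun c hc => N₀.algebraMap_mem ⟨c, hc⟩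
  have hEN : E ≤ N := by
    rw [← hsgen]
    refine Subfield.closure_le.mpr ?_
    rintro y (hy | hy)
    · exact hMN hy
    · refine IntermediateField.subset_adjoin M _ ?_
      refine Polynomial.mem_rootSet.mpr ⟨hq0, ?_⟩
      rw [Polynomial.aeval_def, Polynomial.eval₂_finsetProd, Finset.prod_eq_zero_iff]
      exact ⟨y, hy, by rw [← Polynomial.aeval_def]; exact minpoly.aeval M y⟩
  -- transport `N₀ ≅ N` (same carrier) for finiteness and the Galois property
  have hfinMN : RelFinite M N hMN := relFinite_toSubfield N₀
  have hgalMN := isGalois_toSubfield (M := M) N₀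
  have hdMN : IsDefectlessPair V M N hMN :=
    isDefectlessPair_of_isGalois hyp _ M N hMN hM hfinMN hgalMN rfl
  exact ((isDefectlessPair_tower_iff h hEN hfinMN).mp hdMN).1

/-! ### The purely inseparable part: steps of degree `p` -/

/-- **Extensions reached by `q`-power roots over a `K(x)^h`-field are defectless**: if every
element of the finite extension `E` has a `q^k`-th power in `M` (`q` the characteristic
exponent), then `(E|M, v)` is defectless — by induction on `[E : M]` through steps
`M ≤ M(b) ≤ E` with `b ∉ M`, `b^q ∈ M`, of degree `q = p`, each defectless by the italicized
statement of §5, each `M(b)` again a `K(x')^h`-field (Lemma 5.5).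
[cite: Kuhlmann2010, Section 5, proof of Thm. 1.1 (pp. 19–20)] -/
theorem isDefectlessPair_of_pow_mem (hyp : VTHypotheses K) (n : ℕ) :
    ∀ (M E : Subfield Ω) (h : M ≤ E), IsHenselizedRationalVT V K M → RelFinite M E h →
      (∀ y ∈ E, ∃ k : ℕ, y ^ ringExpChar Ω ^ k ∈ M) →
      relFinrank M E h = n → IsDefectlessPair V M E h := by
  classical
  induction n using Nat.strong_induction_on with
  | _ n ih =>
  intro M E h hM hfin hpow hn
  letI : Algebra M E := (Subfield.inclusion h).toAlgebra
  haveI : IsScalarTower M E Ω := IsScalarTower.of_algebraMap_eq fun _ => rfl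
  haveI : FiniteDimensional M E := hfin
  set q := ringExpChar Ω with hqdef
  -- if `E = M` we are done
  by_cases hEM : E ≤ M
  · have hEq : E = M := le_antisymm hEM h
    subst hEq
    exact isDefectlessPair_of_relFinrank_eq_one h hfin (relFinrank_self_eq_one h hfin h)
  obtain ⟨y, hyE, hyM⟩ := Set.not_subset.mp hEM
  -- minimal `k` with `y^(q^k) ∈ M`; `b = y^(q^(k-1)) ∉ M`, `b^q ∈ M`
  have hex : ∃ k : ℕ, y ^ q ^ k ∈ M := hpow y hyE
  let k := Nat.find hex
  have hk : y ^ q ^ k ∈ M := Nat.find_spec hex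
  have hk0 : k ≠ 0 := fun h0 => hyM (by simpa [h0] using hk)
  have hq1 : q ≠ 1 := fun h1 => hyM (by simpa [h1] using hk)
  have hq2 : 1 < q := by
    have := (expChar_is_prime_or_one Ω q).resolve_right hq1
    exact this.one_lt
  set b : Ω := y ^ q ^ (k - 1) with hbdef
  have hbM : b ∉ M := Nat.find_min hex (Nat.sub_one_lt hk0)
  have hbq : b ^ q ∈ M := by
    have : b ^ q = y ^ q ^ k := by
      rw [hbdef, ← pow_mul, ← pow_succ, Nat.sub_add_cancel (Nat.one_le_iff_ne_zero.mpr hk0)]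
    rw [this]; exact hk
  have hbE : b ∈ E := E.pow_mem hyE _
  -- the step `M ≤ M(b) ≤ E` of degree `q`
  let S : IntermediateField M E := IntermediateField.adjoin M {(⟨b, hbE⟩ : E)}
  let N : Subfield Ω := liftSubfield S
  have hMN : M ≤ N := le_liftSubfield S
  have hNE : N ≤ E := liftSubfield_le S
  have hfinNE : RelFinite N E hNE := relFinite_liftSubfield S
  have hfinMN : RelFinite M N hMN := relFinite_liftSubfield_bot S
  haveI : ExpChar M q := by
    have : ringExpChar M = q := ringExpChar_subfield_eq M
    rw [← this]; infer_instance
  have hdegS : Module.finrank M S = q := by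
    have hbint : IsIntegral M (⟨b, hbE⟩ : E) := (Algebra.IsIntegral.isIntegral (R := M) _)
    rw [IntermediateField.adjoin.finrank hbint]
    -- the minimal polynomial of the purely inseparable `b` is `X^(q^m) - c` with `m = 1`
    haveI : IsPurelyInseparable M S :=
      (IntermediateField.isPurelyInseparable_adjoin_simple_iff_pow_mem M E q).mpr
        ⟨1, ⟨⟨b ^ q, hbq⟩, by rw [pow_one]; exact Subtype.ext rfl⟩⟩
    obtain ⟨m, c, hmc⟩ := IsPurelyInseparable.minpoly_eq_X_pow_sub_C M q
      (IntermediateField.AdjoinSimple.gen M (⟨b, hbE⟩ : E))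
    rw [IntermediateField.minpoly_gen] at hmc
    have hdeg : (minpoly M (⟨b, hbE⟩ : E)).natDegree = q ^ m := by
      rw [hmc, Polynomial.natDegree_X_pow_sub_C]
    -- `m ≠ 0` since `b ∉ M`
    have hm0 : m ≠ 0 := by
      intro hm0
      rw [hm0, pow_zero, pow_one] at hmc
      have hroot := minpoly.aeval M (⟨b, hbE⟩ : E)
      rw [hmc, map_sub, Polynomial.aeval_X, Polynomial.aeval_C, sub_eq_zero] at hroot
      apply hbM
      have : b = ((algebraMap M E c : E) : Ω) := congrArg Subtype.val hroot
      rw [this]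
      exact (algebraMap M E c).2 |> fun hc => by
        rw [coe_algebraMap_of_isScalarTower]; exact c.2
    -- `q^m ≤ q` since the minimal polynomial divides `X^q - b^q`
    have hle : (minpoly M (⟨b, hbE⟩ : E)).natDegree ≤ q := by
      have hdvd : minpoly M (⟨b, hbE⟩ : E) ∣ Polynomial.X ^ q - Polynomial.C ⟨b ^ q, hbq⟩ := by
        refine minpoly.dvd M _ ?_
        rw [map_sub, map_pow, Polynomial.aeval_X, Polynomial.aeval_C, sub_eq_zero]
        exact Subtype.ext rfl
      have hne : (Polynomial.X ^ q - Polynomial.C (⟨b ^ q, hbq⟩ : M)) ≠ 0 :=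
        Polynomial.X_pow_sub_C_ne_zero (by omega) _
      have := Polynomial.natDegree_le_of_dvd hdvd hne
      rwa [Polynomial.natDegree_X_pow_sub_C] at this
    rw [hdeg] at hle ⊢
    have h1 : q ^ 1 ≤ q ^ m := Nat.pow_le_pow_right (by omega) (Nat.one_le_iff_ne_zero.mpr hm0)
    have h2 : q ^ m ≤ q ^ 1 := by rwa [pow_one]
    have := le_antisymm h2 h1
    rw [this, pow_one]
  have hMNdeg : relFinrank M N hMN = q := by rw [relFinrank_eq_liftSubfield, hdegS]
  have hresq : ringExpChar (ResidueField V) = q := ringExpChar_residueField_eq hq2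
  -- the step is defectless, and `N` is again a `K(x')^h`-field
  have hdMN : IsDefectlessPair V M N hMN :=
    hM.isDefectlessPair_of_relFinrank_eq hyp hMN hfinMN (by rw [hresq]; exact hq2)
      (by rw [hresq]; exact hMNdeg)
  have hN : IsHenselizedRationalVT V K N := hM.of_relFinite hyp hMN hfinMN
  -- induction for `E|N`
  have hNEdeg : relFinrank N E hNE = n / q := by
    have ht := (rel_tower (V := V) hMN hNE).2.2
    rw [hMNdeg] at ht
    have : relFinrank M E (hMN.trans hNE) = n := hn
    rw [this] at ht
    rw [ht, Nat.mul_div_cancel_left _ (by omega)]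
  have hn1 : 1 ≤ n := hn ▸ one_le_relFinrank h hfin
  have hlt : n / q < n := Nat.div_lt_self (by omega) hq2
  have hpowN : ∀ y ∈ E, ∃ k : ℕ, y ^ ringExpChar Ω ^ k ∈ N := fun y hy => by
    obtain ⟨k, hk⟩ := hpow y hy
    exact ⟨k, hMN hk⟩
  have hdNE : IsDefectlessPair V N E hNE := ih (n / q) hlt N E hNE hN hfinNE hpowN hNEdeg
  exact ((isDefectlessPair_tower_iff hMN hNE hfin).mpr ⟨hdMN, hdNE⟩)

/-! ### Every finite extension of a `K(x)^h`-field is defectless -/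

/-- **Every finite extension `E` of a henselized rational function field `M = K(x)^h` of rank
one with a value-transcendental generator over an algebraically closed `K` is defectless**,
`[E : M] = (vE : vM)[Ev : Mv]`: split `E|M` at the separable closure `S` of `M` in `E`;
`S|M` is defectless by the separable case, `S` is again a `K(x')^h`-field (Lemma 5.5), and
`E|S` is purely inseparable, hence defectless by the `q`-power case; multiplicativity
(Lemma 2.13) concludes. [cite: Kuhlmann2010, Section 5, proof of Thm. 1.1 (pp. 18–20)] -/
theorem isDefectlessPair_of_isHenselizedRationalVT (hyp : VTHypotheses K) {M E : Subfield Ω}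
    (h : M ≤ E) (hM : IsHenselizedRationalVT V K M) (hfin : RelFinite M E h) :
    IsDefectlessPair V M E h := by
  letI : Algebra M E := (Subfield.inclusion h).toAlgebra
  haveI : IsScalarTower M E Ω := IsScalarTower.of_algebraMap_eq fun _ => rfl
  haveI : FiniteDimensional M E := hfin
  let S₀ : IntermediateField M E := separableClosure M E
  let S : Subfield Ω := liftSubfield S₀
  have hMS : M ≤ S := le_liftSubfield S₀
  have hSE : S ≤ E := liftSubfield_le S₀
  have hfinMS : RelFinite M S hMS := relFinite_liftSubfield_bot S₀
  have hfinSE : RelFinite S E hSE := relFinite_liftSubfield S₀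
  have hsepMS := isSeparable_liftSubfield_bot (M := M) (E := E) S₀
  have hdMS : IsDefectlessPair V M S hMS := isDefectlessPair_of_isSeparable hyp hMS hM hfinMS hsepMS
  have hS : IsHenselizedRationalVT V K S := hM.of_relFinite hyp hMS hfinMS
  -- `E|S` is purely inseparable
  haveI : IsPurelyInseparable S₀ E := separableClosure.isPurelyInseparable M E
  haveI : ExpChar S₀ (ringExpChar Ω) := by
    have : ringExpChar S₀ = ringExpChar Ω :=
      ringExpChar_eq_of_ringHom ((algebraMap E Ω).comp (algebraMap S₀ E))
    rw [← this]; infer_instance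
  have hpow : ∀ y ∈ E, ∃ k : ℕ, y ^ ringExpChar Ω ^ k ∈ S := fun y hy =>
    pow_mem_liftSubfield S₀ (ringExpChar Ω) y hy
  have hdSE : IsDefectlessPair V S E hSE :=
    isDefectlessPair_of_pow_mem hyp _ S E hSE hS hfinSE hpow rfl
  exact ((isDefectlessPair_tower_iff hMS hSE hfin).mpr ⟨hdMS, hdSE⟩)

end Induction

/-! ### `K(x)^h` is a defectless field: the assembly -/

section Assembly

/-- **Kuhlmann 2010, §5, proof of (R4), value-transcendental case: the henselized rational
function field `K(x)^h` of rank one with a value-transcendental generator over an algebraically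
closed `K` is a defectless field**, ASSEMBLED at the level of finite Galois theory from the
named facts "the henselization is henselian" (§1.1 / Lemma 2.3), the Lemma of Ostrowski
((9)), the italicized statement of §5 (p. 19) and Lemma 5.5: a finite extension `L` of
`F = K(x)^h` embeds into `Ω` over `F` (`IsAlgClosed.lift`); its image `E` satisfies
`[E : F] = (vE : vF)[Ev : Fv]` (`isDefectlessPair_of_isHenselizedRationalVT`), `V ∩ E` is the
only extension of `V ∩ F` to `E` (`F` henselian), so `(F, V ∩ F)` is defectless in `E`, and
this is transported back to `L` (`IsDefectlessIn.congr`).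
[cite: Kuhlmann2010, Section 5, proof of Thm. 1.1 (pp. 18–20)] -/
theorem Kuhlmann2010StabilityHenselizedRationalValueTranscendental.of_parts
    (hH : Kuhlmann2010HenselizationIsHenselian.{u}) (hO : Kuhlmann2010OstrowskiLemma.{u})
    (hM : Kuhlmann2010HenselizedRationalImmediateExt.{u})
    (h55 : Kuhlmann2010Lemma55ValueTranscendental.{u}) :
    Kuhlmann2010StabilityHenselizedRationalValueTranscendental.{u} := by
  intro Ω _ _ V K hK x hx hr L _ _ hfinL
  haveI : FiniteDimensional (henselizedAdjoin V K x) L := hfinL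
  have hyp : VTHypotheses K := ⟨hH, hO, hM, h55, hK⟩
  have hF : IsHenselizedRationalVT V K (henselizedAdjoin V K x) := ⟨x, hx, hr, rfl⟩
  -- embed `L` into `Ω` over `F = K(x)^h`
  haveI : Algebra.IsAlgebraic (henselizedAdjoin V K x) L := Algebra.IsAlgebraic.of_finite _ L
  let ι : L →ₐ[henselizedAdjoin V K x] Ω := IsAlgClosed.lift
  let E : Subfield Ω := ι.toRingHom.fieldRange
  let ψ : L ≃+* E := RingEquiv.ofBijective ι.toRingHom.rangeRestrictField
    ι.toRingHom.rangeRestrictField_bijective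
  have hιc : ∀ c : henselizedAdjoin V K x, ι (algebraMap _ L c) = (c : Ω) := fun c => ι.commutes c
  have hFE : henselizedAdjoin V K x ≤ E := fun c hc =>
    RingHom.mem_fieldRange.mpr ⟨algebraMap (henselizedAdjoin V K x) L ⟨c, hc⟩, hιc ⟨c, hc⟩⟩
  letI : Algebra (henselizedAdjoin V K x) E := (Subfield.inclusion hFE).toAlgebra
  have hcompat : ∀ c : henselizedAdjoin V K x,
      ψ (algebraMap _ L c) = algebraMap (henselizedAdjoin V K x) E c := fun c =>
    Subtype.ext (hιc c)
  have hfin : RelFinite (henselizedAdjoin V K x) E hFE :=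
    Module.Finite.of_equiv_equiv (RingEquiv.refl _) ψ
      (RingHom.ext fun c => (hcompat c).symm)
  -- the core: `[E : F] = e f`, and `V ∩ E` is the unique extension
  have hd : IsDefectlessPair V (henselizedAdjoin V K x) E hFE :=
    isDefectlessPair_of_isHenselizedRationalVT hyp hFE hF hfin
  have h1 : IsDefectlessIn (henselizedAdjoin V K x)
      (V.comap (algebraMap (henselizedAdjoin V K x) Ω)) E :=
    isDefectlessIn_of_isDefectlessPair hFE (hF.isHenselianField hyp)
      (forall_isAlgebraic_of_relFinite hFE hfin) hd
  -- back to `L`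
  refine IsDefectlessIn.congr (RingEquiv.refl _) ψ.symm (fun c => ?_) ?_ h1
  · rw [RingEquiv.symm_apply_eq]
    exact (hcompat c).symm
  · ext c; rfl

/-- **Kuhlmann 2010, (R4) for `F = K(t)` of rank one with a value-transcendental generator over
an algebraically closed `K`, from Thm. 2.14, "the henselization is henselian", the Lemma of
Ostrowski, the italicized statement of §5 and Lemma 5.5** — the composite of
`Kuhlmann2010StabilityRankOneValueTranscendental.of_parts` (`GeneralizedStabilityRankOneVT.lean`:
Thm. 2.14 + the assertion for `K(x)^h`) with the finite-Galois-level assembly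
`Kuhlmann2010StabilityHenselizedRationalValueTranscendental.of_parts` of that assertion.
[cite: Kuhlmann2010, Section 5, Lemma 5.4 (R4) and proof of (R4) (pp. 18–20)] -/
theorem Kuhlmann2010StabilityRankOneValueTranscendental.of_facts
    (hT : Kuhlmann2010DefectlessIffHenselization.{u})
    (hH : Kuhlmann2010HenselizationIsHenselian.{u}) (hO : Kuhlmann2010OstrowskiLemma.{u})
    (hM : Kuhlmann2010HenselizedRationalImmediateExt.{u})
    (h55 : Kuhlmann2010Lemma55ValueTranscendental.{u}) :
    Kuhlmann2010StabilityRankOneValueTranscendental.{u} :=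
  Kuhlmann2010StabilityRankOneValueTranscendental.of_parts hT
    (Kuhlmann2010StabilityHenselizedRationalValueTranscendental.of_parts hH hO hM h55)

end Assembly

end Literature.AlgebraicGeometry.Resolution
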